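import Literature.Combinatorics.SimpleGraph.TuttePolynomialChromatic
import Literature.Combinatorics.SimpleGraph.ChromaticPolynomialAcyclicOrientations
import HarnessLib

/-!
# The number of acyclic orientations is `T(G; 2, 0) = R(M(G); 1, −1)` (Godsil–Royle Lemma 15.10.2;
# Stanley 1973)

Sources (held texts; statements VERBATIM).
* C. Godsil, G. Royle, *Algebraic Graph Theory* (Springer GTM 207, 2001) [GodsilRoyle2001] (held
  `book:godsilnd-algebraic-graph-theory`, p0337). **Lemma 15.10.2** «The number of acyclic
  orientations of a graph `X` is `κ(X) = R(M(X); 1, −1)`.» (`R(M; x, y) = Σ_A x^{rk Ω − rk A}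
  y^{|A| − rk A}`, §15.9, so `R(M(X); 1, −1) = T(X; 2, 0)`.)
* R. P. Stanley, *Acyclic orientations of graphs*, Discrete Math. 5 (1973) 171–178 [Stanley1973],
  Corollary 1.3: `a(G) = (−1)^n P(G; −1)` — in the tree as
  `ChromaticPolynomial.eval_chromaticPoly_neg_one` (file `ChromaticPolynomialAcyclicOrientations`).

## What is formalised (`G : SimpleGraph V`, `V` finite; `a(G) = numAcyclicOrientations G` of the
## file `ChromaticPolynomialAcyclicOrientations`; `T = tuttePoly G`, `R = rankPoly G`)

* **Lemma 15.10.2** `aeval_tuttePoly_two_zero` — `T(G; 2, 0) = a(G)` and, as printed,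
  `aeval_rankPoly_one_neg_one` — `R(G; 1, −1) = a(G)`, in every commutative ring: Stanley's
  `a(G) = (−1)^n P(G; −1)` combined with `P(G; x) = (−1)^{r(G)} x^{c(G)} T(G; 1 − x, 0)` (file
  `TuttePolynomialChromatic`) at `x = −1`, where `r(G) + c(G) = n`.
* `natCast_numAcyclicOrientations_eq_sum` — the subgraph expansion
  `a(G) = Σ_{S ⊆ E(G)} (−1)^{s⟨S⟩}` that these evaluations spell out.

Theorems only; no `sorry`; no new definitions.
-/

open Finset MvPolynomial SimpleGraph
open Literature.Combinatorics.SimpleGraph.ChromaticPolynomial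
open Literature.Combinatorics.SimpleGraph.ElementaryGraphSachs
open Literature.Combinatorics.SimpleGraph.SachsCoefficientConsequences

namespace Literature.Combinatorics.SimpleGraph.TuttePolynomial

variable {V : Type*} [Fintype V] (G : SimpleGraph V) [DecidableRel G.Adj]

/-- Stanley's `P(G; −1) = (−1)^n a(G)` in any commutative ring (the tree's integer statement
transported along `ℤ → R`). [cite: Stanley1973, Corollary 1.3] -/
theorem eval_chromaticPoly_neg_one_eq (R : Type*) [CommRing R] :
    (chromaticPoly G R).eval (-1) = (-1) ^ Fintype.card V * (numAcyclicOrientations G : R) := by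
  classical
  have h := eval_chromaticPoly_neg_one G
  apply_fun Int.castRingHom R at h
  rw [← map_chromaticPoly G ℤ (Int.castRingHom R), Polynomial.eval_map,
    show (-1 : R) = Int.castRingHom R (-1) by simp, Polynomial.eval₂_hom, h]
  simp

/-- **Lemma 15.10.2: the number of acyclic orientations is `T(G; 2, 0)`** (`= R(M(G); 1, −1)`),
in every commutative ring. [cite: GodsilRoyle2001, Lemma 15.10.2] [cite: Stanley1973,
Corollary 1.3] -/
theorem aeval_tuttePoly_two_zero (R : Type*) [CommRing R] :
    aeval (![2, 0] : Fin 2 → R) (tuttePoly G) = numAcyclicOrientations G := by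
  have h := eval_chromaticPoly_eq_tuttePoly G R (-1)
  rw [eval_chromaticPoly_neg_one_eq, sub_neg_eq_add, one_add_one_eq_two, ← pow_add,
    rank_add_natCard_connectedComponent] at h
  exact ((isUnit_one.neg.pow _).mul_left_cancel h).symm

/-- **Lemma 15.10.2 as printed: `κ(X) = R(M(X); 1, −1)`.** [cite: GodsilRoyle2001, Lemma 15.10.2] -/
theorem aeval_rankPoly_one_neg_one (R : Type*) [CommRing R] :
    aeval (![1, -1] : Fin 2 → R) (rankPoly G) = numAcyclicOrientations G := by
  rw [← aeval_tuttePoly_two_zero G R, aeval_rankPoly, aeval_tuttePoly]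
  refine sum_congr rfl fun S _ => ?_
  have h2 : (2 : R) - 1 = 1 := by norm_num
  simp only [Matrix.cons_val_zero, Matrix.cons_val_one, h2, zero_sub]

/-- **The subgraph expansion of the number of acyclic orientations:
`a(G) = Σ_{S ⊆ E(G)} (−1)^{s⟨S⟩}`** (`R(M(G); 1, −1)` written out, Godsil–Royle §15.9).
[cite: GodsilRoyle2001, Lemma 15.10.2 with §15.9 (definition of `R(M; x, y)`)] -/
theorem natCast_numAcyclicOrientations_eq_sum (R : Type*) [CommRing R] :
    (numAcyclicOrientations G : R) =
      ∑ S ∈ G.edgeFinset.powerset, (-1 : R) ^ corank (fromEdgeSet (S : Set (Sym2 V))) := by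
  rw [← aeval_rankPoly_one_neg_one G R, aeval_rankPoly]
  simp only [Matrix.cons_val_zero, Matrix.cons_val_one, one_pow, one_mul]

end Literature.Combinatorics.SimpleGraph.TuttePolynomial
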